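import Mathlib
import Summits.MatrixMultiplication.Statement
import Summits.MatrixMultiplication.MatrixMultiplication.Theorems.GraphEquationsJetTruncation
import Summits.MatrixMultiplication.MatrixMultiplication.Theorems.GraphEquationsJetRegularity

/-!
# GraphEquations — the JET BRIDGE: rung `K = 2` of bounded-order purification from two classical
# statements about the polynomial matrix `y ↦ J_C(graphPoint y)` (M18d, decomp-mm-lens-5 g31)

(supports `MultiplicityReduction`, stmt-MatrixMultiplication-27806, hand 1 = BOP′ at `K = 2`.)

With the engine (`GraphEquationsJetTruncation`: correct + JET-DEFLATABLE over some base ⇒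
`R(⟨n,n,n⟩) ≤ 6·cost`) and jet regularity (`GraphEquationsJetRegularity`: test ideal initially
isolated to order `2` over `y` ⇒ REG through the polar tangent), rung `K = 2` —
`EqAdmissibleIdealIso β 2 → β < β' → EqAdmissiblePure β'` — follows from LIFT at a suitable base.
This module types the two remaining inputs as NAMED CLASSICAL STATEMENTS (no cost, no `ω`, no
circuits: local algebra of a polynomial matrix) and proves the assembly:

* `KernelJetLift` (B2) — **kernel vectors at a point of MAXIMAL RANK of a polynomial matrix
  `R(y)` extend to kernel 2-jets**: `R(0) γ = 0`, `rank R(y) ≤ rank R(0) ∀ y` ⇒ there are an affine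
  `ξ = γ + λ·y` and quadratic data `M` with `(ξ·R + R(0)·M)` vanishing in degree `2`.  TRUE
  (generalised Cramer: at a max-rank point the kernel of `R` over `ℂ(y)` specialises onto `ker R(0)`;
  a rational kernel section through `γ` has a 2-jet) — ROUTINE linear algebra over `ℂ[y]`, not yet
  in the tree.
* `IsolationAtMaxRank` (B3) — **if the test ideal of a correct system is initially isolated to
  order `2` over some base, it is so over a base of maximal `C`-Jacobian rank.**  TRUE (the locus of
  order-`2` initial isolation is Zariski-open by properness of `ℙ^{n²-1} × 𝔸 → 𝔸` applied to the
  cone of specialised initial forms, and non-empty; the max-rank locus is non-empty open; affine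
  space is irreducible) — classical ELIMINATION THEORY, a library gap (Mathlib has no proper-image /
  resultant theorem of this shape yet).
* `tangentsLiftAt_of_kernelJetLift`, `jetDeflatableAt_of_tangentsLift`,
  `eqAdmissibleJet_of_bridges`, **`boundedOrderPurification_two_of_bridges :
  KernelJetLift → IsolationAtMaxRank → (∀ β ≥ 2, EqAdmissibleIdealIso β 2 → ∀ β' > β, EqAdmissiblePure β')`**
  — rung `2` of `stub_boundedOrderPurification` modulo B2 ∧ B3, and nothing else.

Why the base must move (the toy obstruction, recorded g31): at a rank-JUMP base `y₀` a generic
tangent `γ ∈ ker J_C(x₀)` need not extend to a kernel 1-jet (tower `T(0) = ℂ^k ⊋ T_lim = ⟨e_k⟩`),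
so LIFT can fail exactly where the tree's isolation hypothesis is given; REG is not upper
semicontinuous across the jump either.  Hence B3.

No `sorry`.  Sources: [LeykinVerscheldeZhao2006, Thm. 3.1, §3]; [HauensteinWampler2013, §2
(isosingular sets, deflation sequences)]; [BurgisserClausenShokrollahi1997, (14.8)];
[CoxLittleOShea2015, Ch. 8 §5 Thm. 6 (projective elimination / properness)].
-/

set_option linter.dupNamespace false

noncomputable section

open scoped BigOperators

namespace Summit.MatrixMultiplication.MatrixMultiplication.Theorems.GraphEquations

open MvPolynomial
open Literature.Computability.AlgebraicComplexity

variable {n : ℕ}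

/-! ## Affine fields -/

/-- The AFFINE coefficient field `ξ_q = γ_q + Σ_v λ_{qv} X_v` with value `γ` at the origin. -/
def affField (γ : Fin n × Fin n → ℂ) (lam : Fin n × Fin n → MatMulVars n → ℂ) :
    Fin n × Fin n → MvPolynomial (MatMulVars n) ℂ :=
  fun q => C (γ q) + ∑ v, lam q v • X v

/-- Affine fields are cost-free. -/
theorem liftAB_affField_mem_freeSpan (γ : Fin n × Fin n → ℂ) (lam : Fin n × Fin n → MatMulVars n → ℂ)
    (q : Fin n × Fin n) :
    liftAB n (affField γ lam q) ∈ freeSpan (∅ : Set (MvPolynomial (GraphVars n) ℂ)) :=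
  liftAB_affine_mem_freeSpan (γ q) (lam q)

/-- `ξ(0) = γ`. -/
@[simp] theorem eval_zero_affField (γ : Fin n × Fin n → ℂ) (lam : Fin n × Fin n → MatMulVars n → ℂ)
    (q : Fin n × Fin n) : eval 0 (affField γ lam q) = γ q := by
  simp [affField]

/-! ## The two classical inputs -/

/-- **B2 — KERNEL 2-JETS AT A POINT OF MAXIMAL RANK.**  For a matrix `R` of polynomials over `ℂ`
(rows `Fin T`, columns `Fin n × Fin n`, variables `MatMulVars n`): if `rank R(y) ≤ rank R(0)` for
every `y` and `R(0) γ = 0`, then `γ` extends to a kernel 2-jet — an affine field `ξ = γ + λ·y` and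
polynomials `M_q` with `coeff_m (Σ_q ξ_q R_{oq} + Σ_q R_{oq}(0) M_q) = 0` for every monomial `m` of
degree `2` and every row `o`.  (Classical: constant rank near `0` ⇒ the kernel is a vector bundle
there; a rational kernel section through `γ`, regular at `0`, exists by Cramer's rule on a maximal
non-vanishing minor; take its 2-jet.) -/
def KernelJetLift : Prop :=
  ∀ (n T : ℕ) (R : Fin T → Fin n × Fin n → MvPolynomial (MatMulVars n) ℂ),
    (∀ y : MatMulVars n → ℂ,
      (Matrix.of fun o q => eval y (R o q)).rank ≤ (Matrix.of fun o q => eval 0 (R o q)).rank) →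
    ∀ γ : Fin n × Fin n → ℂ, (Matrix.of fun o q => eval 0 (R o q)).mulVec γ = 0 →
      ∃ (lam : Fin n × Fin n → MatMulVars n → ℂ) (M : Fin n × Fin n → MvPolynomial (MatMulVars n) ℂ),
        ∀ (o : Fin T) (m : MatMulVars n →₀ ℕ), m.degree = 2 →
          coeff m (∑ q, affField γ lam q * R o q + ∑ q, C (eval 0 (R o q)) * M q) = 0

namespace EqSystem

/-- `y` is a base of MAXIMAL `C`-JACOBIAN RANK for `E`. -/
def MaxRankAt (E : EqSystem n) (y : MatMulVars n → ℂ) : Prop :=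
  ∀ y' : MatMulVars n → ℂ, (E.jacobianC (graphPoint y')).rank ≤ (E.jacobianC (graphPoint y)).rank

/-- **ALL TANGENTS LIFT over `y`**: every `γ ∈ ker J_C(graphPoint y)` is the value at `0` of a
cost-free (affine) field `ξ` admitting quadratic data `M` with LIFT for the translated tests. -/
def TangentsLiftAt (E : EqSystem n) (y : MatMulVars n → ℂ) : Prop :=
  ∀ γ : Fin n × Fin n → ℂ, (E.jacobianC (graphPoint y)).mulVec γ = 0 →
    ∃ ξ M : Fin n × Fin n → MvPolynomial (MatMulVars n) ℂ,
      (∀ q, liftAB n (ξ q) ∈ freeSpan (∅ : Set (MvPolynomial (GraphVars n) ℂ))) ∧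
      (∀ q, eval 0 (ξ q) = γ q) ∧
      ∀ (o : Fin E.tests.length) (i j j' l : Fin n),
        coeff (Finsupp.single (Sum.inl (i, j) : MatMulVars n) 1 +
            Finsupp.single (Sum.inr (j', l) : MatMulVars n) 1)
          (∑ q, ξ q * rowPoly (GraphEquations.translate y (E.testPoly (E.tests.get o))) q +
            ∑ q, C (E.jacobianC (graphPoint y) o q) * M q) = 0

end EqSystem

/-- **B3 — ISOLATION AT A MAX-RANK BASE.**  If the test ideal of a correct system is initially
isolated to order `2` over some base, then it is so over some base of maximal `C`-Jacobian rank.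
(Classical: both loci are non-empty Zariski-open subsets of the irreducible base space `ℂ^{2n²}`;
openness of the isolation locus is the properness of `ℙ × 𝔸 → 𝔸` — elimination theory.) -/
def IsolationAtMaxRank : Prop :=
  ∀ (n : ℕ) (E : EqSystem n) (y₀ : MatMulVars n → ℂ), E.Correct → E.IdealInitIsolatedAt 2 y₀ →
    ∃ y : MatMulVars n → ℂ, E.IdealInitIsolatedAt 2 y ∧ E.MaxRankAt y

/-! ## The assembly -/

namespace EqSystem

/-- The row matrix of the translated tests, evaluated at `y'`, is the `C`-Jacobian at the graph
point over `y' + y`. -/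
theorem rowMatrix_translate_eval (E : EqSystem n) (y y' : MatMulVars n → ℂ) :
    (Matrix.of fun (o : Fin E.tests.length) (q : Fin n × Fin n) =>
        eval y' (rowPoly (GraphEquations.translate y (E.testPoly (E.tests.get o))) q)) =
      E.jacobianC (graphPoint (y' + y)) := by
  ext o q
  simp only [Matrix.of_apply, jacobianC, eval_rowPoly, eval_graphPoint_pderiv_inr_translate]

/-- **B2 ⇒ all tangents lift over a max-rank base.** -/
theorem tangentsLiftAt_of_kernelJetLift (hL : KernelJetLift) {E : EqSystem n}
    {y : MatMulVars n → ℂ} (hmax : E.MaxRankAt y) : E.TangentsLiftAt y := by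
  intro γ hγ
  set R : Fin E.tests.length → Fin n × Fin n → MvPolynomial (MatMulVars n) ℂ := fun o q =>
    rowPoly (GraphEquations.translate y (E.testPoly (E.tests.get o))) q with hR
  have hR0 : (Matrix.of fun o q => eval 0 (R o q)) = E.jacobianC (graphPoint y) := by
    rw [hR, rowMatrix_translate_eval, zero_add]
  have hrank : ∀ y' : MatMulVars n → ℂ,
      (Matrix.of fun o q => eval y' (R o q)).rank ≤ (Matrix.of fun o q => eval 0 (R o q)).rank := by
    intro y'
    rw [hR0, hR, rowMatrix_translate_eval]
    exact hmax _
  obtain ⟨lam, M, hlift⟩ := hL n E.tests.length R hrank γ (by rw [hR0]; exact hγ)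
  refine ⟨affField γ lam, M, liftAB_affField_mem_freeSpan γ lam, eval_zero_affField γ lam,
    fun o i j j' l => ?_⟩
  have hdeg : (Finsupp.single (Sum.inl (i, j) : MatMulVars n) 1 +
      Finsupp.single (Sum.inr (j', l) : MatMulVars n) 1).degree = 2 := by
    rw [map_add, Finsupp.degree_single, Finsupp.degree_single]
  have h := hlift o _ hdeg
  have hJ : ∀ q, eval 0 (R o q) = E.jacobianC (graphPoint y) o q := fun q => by
    have := congrFun (congrFun hR0 o) q
    simpa only [Matrix.of_apply] using this
  simp only [hJ] at h
  exact h

/-- **Isolation to order `2` over `y` + all tangents lift over `y` ⇒ jet-deflatable over `y`**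
(REG from `jetRegularAt`, LIFT from the hypothesis at the polar tangent). -/
theorem jetDeflatableAt_of_tangentsLift {E : EqSystem n} (hE : E.Correct) {y : MatMulVars n → ℂ}
    (hiso : E.IdealInitIsolatedAt 2 y) (hT : E.TangentsLiftAt y) : E.JetDeflatableAt y := by
  obtain ⟨γ, hγ, hreg⟩ := jetRegularAt hE hiso
  obtain ⟨ξ, M, hξ, hξ0, hlift⟩ := hT γ hγ
  exact ⟨ξ, M, hξ, hlift, hreg ξ hξ0⟩

end EqSystem

/-- **B2 ∧ B3 ⇒ every `H_iso(2)`-family is a jet-deflatable family of the same cost.** -/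
theorem eqAdmissibleJet_of_bridges (hL : KernelJetLift) (hI : IsolationAtMaxRank) {β : ℝ}
    (h : EqAdmissibleIdealIso β 2) : EqAdmissibleJet β := by
  obtain ⟨c, hc⟩ := h
  refine ⟨c, fun n hn => ?_⟩
  obtain ⟨E, hE, ⟨y₀, hiso⟩, hcost⟩ := hc n hn
  obtain ⟨y, hiso', hmax⟩ := hI n E y₀ hE hiso
  exact ⟨E, y, hE, EqSystem.jetDeflatableAt_of_tangentsLift hE hiso'
    (EqSystem.tangentsLiftAt_of_kernelJetLift hL hmax), hcost⟩

/-- **RUNG `K = 2` OF BOUNDED-ORDER PURIFICATION from B2 ∧ B3**: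
`KernelJetLift → IsolationAtMaxRank → ∀ β ≥ 2, EqAdmissibleIdealIso β 2 → ∀ β' > β, EqAdmissiblePure β'`. -/
theorem boundedOrderPurification_two_of_bridges (hL : KernelJetLift) (hI : IsolationAtMaxRank) :
    ∀ β : ℝ, 2 ≤ β → EqAdmissibleIdealIso β 2 → ∀ β' : ℝ, β < β' → EqAdmissiblePure β' :=
  fun _ _ h _ hββ' => eqAdmissiblePure_of_eqAdmissibleJet (eqAdmissibleJet_of_bridges hL hI h) hββ'

/-- The same in the currency of `MultiplicityReduction` (reduced systems above `β`). -/
theorem eqAdmissibleRed_of_bridges (hL : KernelJetLift) (hI : IsolationAtMaxRank) {β : ℝ}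
    (h : EqAdmissibleIdealIso β 2) {β' : ℝ} (hββ' : β < β') : EqAdmissibleRed β' :=
  eqAdmissibleRed_of_eqAdmissibleJet (eqAdmissibleJet_of_bridges hL hI h) hββ'

/-- And `ω ≤ β` outright. -/
theorem omega_le_of_bridges (hL : KernelJetLift) (hI : IsolationAtMaxRank) {β : ℝ}
    (h : EqAdmissibleIdealIso β 2) : omega ℂ ≤ β :=
  omega_le_of_eqAdmissibleJet (eqAdmissibleJet_of_bridges hL hI h)

end Summit.MatrixMultiplication.MatrixMultiplication.Theorems.GraphEquations

end
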